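import Mathlib.Algebra.Order.Chebyshev
import Mathlib.Algebra.Order.BigOperators.Ring.Finset
import Literature.MathematicalPhysics.KineticTheory.HardSphereTwoTimePressure
import HarnessLib

/-!
# Quartic content of the local Gibbs datum (stub Q0 of the line `quartic-schur-ledger`,
# crux `EnergyCurrentTails`, stmt-AtomisticToContinuum-9235)

Stub worker file for the registered stub `stub_quarticData` of the line lead's skeleton
`Cruxes/EnergyCurrentTails/Lines/quartic_schur_ledger.lean` (primary crux decl
`Summit.AtomisticToContinuum.HydrodynamicLimit.Theses.WarmColdDichotomy.EnergyCurrentTails`, route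
copy `…Theses.OneFlightGossipEngine.EnergyCurrentTails`).  The statement only mentions the
Literature prelude (`T3`, `V3`, `hsDiameter`, `localGibbsLaw`, `HardSphereFlow.flow`), so no
`Summits` module is imported.

**Statement.**  For continuous profiles `a₀, θ₀ > 0`, `u₀` there is `σ₀ > 0` (`1/2` works) such
that for `0 < σ < σ₀` and every flow family `Φ N`, with `λ_N = localGibbsLaw σ a₀ u₀ θ₀ N (Φ N)`
and `y_N(r) = ∫ (N+1)⁻¹ ∑ᵢ ‖vᵢ(r)‖⁴ dλ_N` (`vᵢ(r) = ((Φ N).flow r z i).2`):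
(i) `y_N(0) ≤ B` for all `N ≥ N₀ = 0`, with the `N`-uniform constant
`B = 8 U⁴ + 8 (max θ₀)² K₄`, `U ≥ ‖u₀‖`, `K₄ = ∫ ‖w‖⁴ dN(0, id)`;
(ii) for each `N` a crude bound `y_N(r) ≤ B'_N = (N+1) B` for ALL `r`.

**Proof.**  (i) Given the positions the local Gibbs velocities are independent Gaussians
`N(u₀(xᵢ), θ₀(xᵢ) id)` (disintegration `lintegral_localGibbsMeasure`), and for one such Gaussian
`E ‖u + √θ w‖⁴ ≤ 8‖u‖⁴ + 8θ² E‖w‖⁴` (`(a+b)⁴ ≤ 8a⁴ + 8b⁴`); the position marginal has mass one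
(`lintegral_posWeight_eq_one`, `σ ≤ 1/2`), and `Φ_0 = id` on the `λ_N`-conull good set.
(ii) Pathwise on the good set `∑ᵢ‖vᵢ(r)‖⁴ ≤ (∑ᵢ‖vᵢ(r)‖²)² = (∑ᵢ‖vᵢ(0)‖²)²` by conservation of
the kinetic energy (`IsHardSphereTrajectory.configEnergy_eq_holds`) `≤ (N+1) ∑ᵢ‖vᵢ(0)‖⁴`
(Cauchy–Schwarz), and (i) without the `(N+1)⁻¹` integrates the right-hand side.

References: H. Spohn, *Large Scale Dynamics of Interacting Particles* (1991) Part I §2.3 (local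
equilibrium states); C. Cercignani, R. Illner, M. Pulvirenti, *The Mathematical Theory of Dilute
Gases* (1994) §4.2 (energy conservation along hard-sphere trajectories).
-/

noncomputable section

open MeasureTheory Set Filter
open scoped ENNReal

namespace Summit.AtomisticToContinuum.HydrodynamicLimit.Theorems.QuarticSchurLedger

open Literature.MathematicalPhysics.KineticTheory Literature.Analysis.FluidPDE

/-! ## One-body Gaussian quartic moment -/

/-- The elementary convexity bound `(a + b)⁴ ≤ 8 a⁴ + 8 b⁴`. [folklore] -/
theorem add_pow_four_le (a b : ℝ) : (a + b) ^ 4 ≤ 8 * a ^ 4 + 8 * b ^ 4 := by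
  have h1 : (a + b) ^ 2 ≤ 2 * (a ^ 2 + b ^ 2) := by nlinarith [sq_nonneg (a - b)]
  have h2 : (a + b) ^ 4 = ((a + b) ^ 2) ^ 2 := by ring
  have h3 : ((a + b) ^ 2) ^ 2 ≤ (2 * (a ^ 2 + b ^ 2)) ^ 2 := pow_le_pow_left₀ (sq_nonneg _) h1 2
  nlinarith [sq_nonneg (a ^ 2 - b ^ 2)]

/-- Pointwise quartic bound for the affine Gaussian map `w ↦ u + √θ w` (`θ ≥ 0`):
`‖u + √θ w‖⁴ ≤ 8‖u‖⁴ + 8 θ² ‖w‖⁴`. [folklore] -/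
theorem norm_add_sqrt_smul_pow_four_le (u w : V3) {θ : ℝ} (hθ : 0 ≤ θ) :
    ‖u + Real.sqrt θ • w‖ ^ 4 ≤ 8 * ‖u‖ ^ 4 + 8 * θ ^ 2 * ‖w‖ ^ 4 := by
  have h1 : ‖u + Real.sqrt θ • w‖ ≤ ‖u‖ + Real.sqrt θ * ‖w‖ := by
    calc ‖u + Real.sqrt θ • w‖ ≤ ‖u‖ + ‖Real.sqrt θ • w‖ := norm_add_le _ _
      _ = ‖u‖ + Real.sqrt θ * ‖w‖ := by
          rw [norm_smul, Real.norm_of_nonneg (Real.sqrt_nonneg θ)]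
  have hsq : Real.sqrt θ ^ 4 = θ ^ 2 := by
    rw [show (4 : ℕ) = 2 * 2 by norm_num, pow_mul, Real.sq_sqrt hθ]
  calc ‖u + Real.sqrt θ • w‖ ^ 4 ≤ (‖u‖ + Real.sqrt θ * ‖w‖) ^ 4 :=
        pow_le_pow_left₀ (norm_nonneg _) h1 4
    _ ≤ 8 * ‖u‖ ^ 4 + 8 * (Real.sqrt θ * ‖w‖) ^ 4 := add_pow_four_le _ _
    _ = 8 * ‖u‖ ^ 4 + 8 * θ ^ 2 * ‖w‖ ^ 4 := by rw [mul_pow, hsq, mul_assoc]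

/-- **One-body Gaussian quartic moment.**  For `θ ≥ 0`,
`∫ ‖v‖⁴ N(u, θ id)(dv) ≤ 8‖u‖⁴ + 8θ² K₄` with `K₄ = ∫ ‖w‖⁴ N(0, id)(dw)` (finite by Fernique,
`integrable_norm_pow_four_stdGaussian`): transfer to the standard Gaussian
(`gaussMeasure u θ = (w ↦ u + √θ w)_* N(0, id)`) and the pointwise bound
`norm_add_sqrt_smul_pow_four_le`. [folklore] -/
theorem lintegral_norm_pow_four_gaussMeasure_le (u : V3) {θ : ℝ} (hθ : 0 ≤ θ) :
    ∫⁻ v, ENNReal.ofReal (‖v‖ ^ 4) ∂gaussMeasure u θ ≤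
      ENNReal.ofReal (8 * ‖u‖ ^ 4 + 8 * θ ^ 2 *
        ∫ w, ‖w‖ ^ 4 ∂ProbabilityTheory.stdGaussian V3) := by
  have hm : Measurable fun v : V3 => ENNReal.ofReal (‖v‖ ^ 4) :=
    (measurable_norm.pow_const 4).ennreal_ofReal
  have hK : 0 ≤ ∫ w, ‖w‖ ^ 4 ∂ProbabilityTheory.stdGaussian V3 :=
    integral_nonneg fun w => by positivity
  rw [gaussMeasure, lintegral_map hm (measurable_gaussShift u θ)]
  calc ∫⁻ w, ENNReal.ofReal (‖u + Real.sqrt θ • w‖ ^ 4) ∂ProbabilityTheory.stdGaussian V3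
      ≤ ∫⁻ w, ENNReal.ofReal (8 * ‖u‖ ^ 4) +
          ENNReal.ofReal (8 * θ ^ 2) * ENNReal.ofReal (‖w‖ ^ 4)
            ∂ProbabilityTheory.stdGaussian V3 := by
        refine lintegral_mono fun w => ?_
        rw [← ENNReal.ofReal_mul (by positivity),
          ← ENNReal.ofReal_add (by positivity) (by positivity)]
        exact ENNReal.ofReal_le_ofReal (norm_add_sqrt_smul_pow_four_le u w hθ)
    _ = ENNReal.ofReal (8 * ‖u‖ ^ 4) + ENNReal.ofReal (8 * θ ^ 2) *
          ∫⁻ w, ENNReal.ofReal (‖w‖ ^ 4) ∂ProbabilityTheory.stdGaussian V3 := by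
        rw [lintegral_add_left measurable_const, lintegral_const, measure_univ, mul_one,
          lintegral_const_mul _ hm]
    _ = _ := by
        rw [← ofReal_integral_eq_lintegral_ofReal integrable_norm_pow_four_stdGaussian
            (ae_of_all _ fun w => by positivity),
          ← ENNReal.ofReal_mul (by positivity),
          ← ENNReal.ofReal_add (by positivity) (mul_nonneg (by positivity) hK)]

/-! ## Quartic moments under the local Gibbs law -/

/-- **Per-particle quartic moment under the local Gibbs law**, uniformly in the particle and in
`N`: if `‖u₀‖ ≤ U` and `θ₀ ≤ θM` then for `σ ≤ 1/2` and every particle `i`,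
`∫ ‖vᵢ‖⁴ dλ_N ≤ 8U⁴ + 8θM² K₄`.  Disintegrate `λ_N` into positions and independent Gaussian
velocities (`lintegral_localGibbsMeasure`), bound the one-body integral by
`lintegral_norm_pow_four_gaussMeasure_le`, and use that the position marginal has mass one
(`lintegral_posWeight_eq_one`). [folklore] -/
theorem lintegral_norm_pow_four_localGibbsLaw_le {a₀ θ₀ : T3 → ℝ} {u₀ : T3 → V3}
    (ha : Continuous a₀) (hθ : Continuous θ₀) (hu : Continuous u₀)
    (ha0 : ∀ x, 0 < a₀ x) (hθ0 : ∀ x, 0 < θ₀ x) {U θM : ℝ} (hU : ∀ x, ‖u₀ x‖ ≤ U)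
    (hθM : ∀ x, θ₀ x ≤ θM) {σ : ℝ} (hσ2 : σ ≤ 1 / 2) (N : ℕ)
    (Φ : HardSphereFlow (Torus.geometry (Fin 3)) (hsDiameter σ N) (N + 1)) (i : Fin (N + 1)) :
    ∫⁻ z, ENNReal.ofReal (‖(z i).2‖ ^ 4) ∂(localGibbsLaw σ a₀ u₀ θ₀ N Φ) ≤
      ENNReal.ofReal (8 * U ^ 4 + 8 * θM ^ 2 *
        ∫ w, ‖w‖ ^ 4 ∂ProbabilityTheory.stdGaussian V3) := by
  have ha0' : ∀ x, 0 ≤ a₀ x := fun x => (ha0 x).le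
  haveI := isProbabilityMeasure_localGibbsMeasure ha hθ hu ha0 hθ0 hσ2 N
  have hG : Measurable fun z : Config (N + 1) (Fin 3) T3 => ENNReal.ofReal (‖(z i).2‖ ^ 4) :=
    ((measurable_pi_apply i).snd.norm.pow_const 4).ennreal_ofReal
  have hg : Measurable fun w : V3 => ENNReal.ofReal (‖w‖ ^ 4) :=
    (measurable_norm.pow_const 4).ennreal_ofReal
  have hK : 0 ≤ ∫ w, ‖w‖ ^ 4 ∂ProbabilityTheory.stdGaussian V3 :=
    integral_nonneg fun w => by positivity
  have hZm : Measurable fun x : Fin (N + 1) → T3 => ENNReal.ofReal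
      ((canonicalPartition (Torus.geometry (Fin 3)) (hsDiameter σ N) (N + 1)
        (localGibbsProfile a₀ u₀ θ₀))⁻¹ * posWeight a₀ (hsDiameter σ N) (N + 1) x) :=
    ((measurable_posWeight ha _ _).const_mul _).ennreal_ofReal
  -- the one-body inner bound, uniformly in the positions
  have hinner : ∀ x : Fin (N + 1) → T3,
      ∫⁻ v, ENNReal.ofReal (‖v i‖ ^ 4) ∂velMeasure u₀ θ₀ x ≤
        ENNReal.ofReal (8 * U ^ 4 + 8 * θM ^ 2 *
          ∫ w, ‖w‖ ^ 4 ∂ProbabilityTheory.stdGaussian V3) := by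
    intro x
    have hmp : MeasurePreserving (Function.eval i) (velMeasure u₀ θ₀ x)
        (gaussMeasure (u₀ (x i)) (θ₀ (x i))) := by
      unfold velMeasure
      exact measurePreserving_eval _ i
    calc ∫⁻ v, ENNReal.ofReal (‖v i‖ ^ 4) ∂velMeasure u₀ θ₀ x
        = ∫⁻ w, ENNReal.ofReal (‖w‖ ^ 4) ∂gaussMeasure (u₀ (x i)) (θ₀ (x i)) :=
          hmp.lintegral_comp hg
      _ ≤ ENNReal.ofReal (8 * ‖u₀ (x i)‖ ^ 4 + 8 * θ₀ (x i) ^ 2 *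
            ∫ w, ‖w‖ ^ 4 ∂ProbabilityTheory.stdGaussian V3) :=
          lintegral_norm_pow_four_gaussMeasure_le _ (hθ0 _).le
      _ ≤ _ := by
          refine ENNReal.ofReal_le_ofReal (add_le_add ?_ ?_)
          · exact mul_le_mul_of_nonneg_left
              (pow_le_pow_left₀ (norm_nonneg _) (hU _) 4) (by norm_num)
          · exact mul_le_mul_of_nonneg_right (mul_le_mul_of_nonneg_left
              (pow_le_pow_left₀ (hθ0 _).le (hθM _) 2) (by norm_num)) hK
  rw [localGibbsLaw_eq, lintegral_localGibbsMeasure ha hθ hu ha0' hθ0 σ N hG]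
  simp only [zipConfig_apply]
  refine (lintegral_mono fun x => mul_le_mul_right (hinner x) _).trans_eq ?_
  rw [lintegral_mul_const _ hZm, lintegral_posWeight_eq_one ha hθ hu ha0' hθ0 σ N, one_mul]

/-- **Total quartic content of the local Gibbs datum**: under the hypotheses of
`lintegral_norm_pow_four_localGibbsLaw_le`, `∫ ∑ᵢ ‖vᵢ‖⁴ dλ_N ≤ (N+1) (8U⁴ + 8θM² K₄)`
(sum the per-particle bounds). [folklore] -/
theorem lintegral_quarticSum_localGibbsLaw_le {a₀ θ₀ : T3 → ℝ} {u₀ : T3 → V3}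
    (ha : Continuous a₀) (hθ : Continuous θ₀) (hu : Continuous u₀)
    (ha0 : ∀ x, 0 < a₀ x) (hθ0 : ∀ x, 0 < θ₀ x) {U θM : ℝ} (hU : ∀ x, ‖u₀ x‖ ≤ U)
    (hθM : ∀ x, θ₀ x ≤ θM) {σ : ℝ} (hσ2 : σ ≤ 1 / 2) (N : ℕ)
    (Φ : HardSphereFlow (Torus.geometry (Fin 3)) (hsDiameter σ N) (N + 1)) :
    ∫⁻ z, ENNReal.ofReal (∑ i, ‖(z i).2‖ ^ 4) ∂(localGibbsLaw σ a₀ u₀ θ₀ N Φ) ≤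
      ENNReal.ofReal (((N : ℝ) + 1) * (8 * U ^ 4 + 8 * θM ^ 2 *
        ∫ w, ‖w‖ ^ 4 ∂ProbabilityTheory.stdGaussian V3)) := by
  have hmeas : ∀ i : Fin (N + 1),
      Measurable fun z : Config (N + 1) (Fin 3) T3 => ENNReal.ofReal (‖(z i).2‖ ^ 4) :=
    fun i => ((measurable_pi_apply i).snd.norm.pow_const 4).ennreal_ofReal
  calc ∫⁻ z, ENNReal.ofReal (∑ i, ‖(z i).2‖ ^ 4) ∂(localGibbsLaw σ a₀ u₀ θ₀ N Φ)
      = ∫⁻ z, ∑ i, ENNReal.ofReal (‖(z i).2‖ ^ 4) ∂(localGibbsLaw σ a₀ u₀ θ₀ N Φ) :=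
        lintegral_congr fun z => ENNReal.ofReal_sum_of_nonneg fun i _ => by positivity
    _ = ∑ i, ∫⁻ z, ENNReal.ofReal (‖(z i).2‖ ^ 4) ∂(localGibbsLaw σ a₀ u₀ θ₀ N Φ) :=
        lintegral_finsetSum _ fun i _ => hmeas i
    _ ≤ ∑ _i : Fin (N + 1), ENNReal.ofReal (8 * U ^ 4 + 8 * θM ^ 2 *
          ∫ w, ‖w‖ ^ 4 ∂ProbabilityTheory.stdGaussian V3) :=
        Finset.sum_le_sum fun i _ =>
          lintegral_norm_pow_four_localGibbsLaw_le ha hθ hu ha0 hθ0 hU hθM hσ2 N Φ i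
    _ = _ := by
        rw [Finset.sum_const, Finset.card_univ, Fintype.card_fin, nsmul_eq_mul,
          ENNReal.ofReal_mul (by positivity)]
        congr 1
        rw [← ENNReal.ofReal_natCast]
        push_cast
        rfl

/-! ## Pathwise crude bound along the flow (energy conservation) -/

/-- **Pathwise crude quartic bound along a hard-sphere flow.**  On the good set,
`∑ᵢ ‖vᵢ(r)‖⁴ ≤ (∑ᵢ ‖vᵢ(r)‖²)² = (∑ᵢ ‖vᵢ(0)‖²)² ≤ (N+1) ∑ᵢ ‖vᵢ(0)‖⁴`: conservation of the
kinetic energy (`IsHardSphereTrajectory.configEnergy_eq_holds`, `Φ_0 = id` on the good set) and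
Cauchy–Schwarz (`sq_sum_le_card_mul_sum_sq`). [folklore] -/
theorem quarticSum_flow_le_card_mul {N : ℕ} {ε : ℝ}
    (Φ : HardSphereFlow (Torus.geometry (Fin 3)) ε (N + 1)) {z : Config (N + 1) (Fin 3) T3}
    (hz : z ∈ Φ.good) (r : ℝ) :
    ∑ i, ‖(Φ.flow r z i).2‖ ^ 4 ≤ ((N : ℝ) + 1) * ∑ i, ‖(z i).2‖ ^ 4 := by
  -- conservation of the kinetic energy between times `r` and `0`
  have hE : ∑ i, ‖(Φ.flow r z i).2‖ ^ 2 = ∑ i, ‖(z i).2‖ ^ 2 := by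
    have h := IsHardSphereTrajectory.configEnergy_eq_holds (Φ.isTrajectory z hz) r 0
    simp only [configEnergy] at h
    rw [Φ.flow_zero z hz] at h
    linarith
  have h4 : ∀ v : V3, ‖v‖ ^ 4 = (‖v‖ ^ 2) ^ 2 := fun v => by ring
  calc ∑ i, ‖(Φ.flow r z i).2‖ ^ 4 = ∑ i, (‖(Φ.flow r z i).2‖ ^ 2) ^ 2 := by simp_rw [h4]
    _ ≤ (∑ i, ‖(Φ.flow r z i).2‖ ^ 2) ^ 2 :=
        Finset.sum_sq_le_sq_sum_of_nonneg fun i _ => by positivity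
    _ = (∑ i, ‖(z i).2‖ ^ 2) ^ 2 := by rw [hE]
    _ ≤ ((Finset.univ : Finset (Fin (N + 1))).card : ℝ) * ∑ i, (‖(z i).2‖ ^ 2) ^ 2 :=
        sq_sum_le_card_mul_sum_sq
    _ = ((N : ℝ) + 1) * ∑ i, ‖(z i).2‖ ^ 4 := by
        rw [Finset.card_univ, Fintype.card_fin, Nat.cast_add_one]
        simp_rw [h4]

/-! ## The stub -/

/-- **Stub Q0 — QUARTIC CONTENT OF THE DATUM AND CRUDE FINITENESS ALONG THE FLOW** (line
`quartic-schur-ledger`, crux stmt-AtomisticToContinuum-9235 `EnergyCurrentTails`).  For continuous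
positive profiles there is `σ₀ > 0` (`1/2` works) such that for `0 < σ < σ₀` and every flow
family `Φ N`, with `λ_N = localGibbsLaw σ a₀ u₀ θ₀ N (Φ N)` and
`y_N(r) = ∫ (N+1)⁻¹ ∑ᵢ ‖vᵢ(r)‖⁴ dλ_N`:
(i) `y_N(0) ≤ B` for all `N ≥ N₀` (`N₀ = 0`), with the `N`-uniform
`B = 8U⁴ + 8(max θ₀)² K₄` (`U ≥ ‖u₀‖`, `K₄ = ∫ ‖w‖⁴ dN(0, id)`) — given the positions the local
Gibbs velocities are independent Gaussians (`lintegral_norm_pow_four_localGibbsLaw_le`) and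
`(Φ N).flow 0 = id` on the conull good set (`ae_mem_good_localGibbsLaw`);
(ii) for each `N` the crude bound `y_N(r) ≤ B'_N = (N+1) B` for ALL `r` — pathwise
`∑ᵢ‖vᵢ(r)‖⁴ ≤ (N+1) ∑ᵢ‖vᵢ(0)‖⁴` by energy conservation on the good set
(`quarticSum_flow_le_card_mul`), integrated by `lintegral_quarticSum_localGibbsLaw_le`.
[folklore] -/
theorem stub_quarticData :
    ∀ (a₀ θ₀ : T3 → ℝ) (u₀ : T3 → V3), Continuous a₀ → Continuous θ₀ → Continuous u₀ →
      (∀ x, 0 < a₀ x) → (∀ x, 0 < θ₀ x) →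
      ∃ σ₀ : ℝ, 0 < σ₀ ∧ ∀ σ : ℝ, 0 < σ → σ < σ₀ →
        ∀ Φ : (N : ℕ) → HardSphereFlow (Torus.geometry (Fin 3)) (hsDiameter σ N) (N + 1),
          ∃ B : ℝ, 0 ≤ B ∧ ∃ N₀ : ℕ, ∀ N : ℕ, N₀ ≤ N →
            (∫⁻ z, ENNReal.ofReal (((N : ℝ) + 1)⁻¹ *
                ∑ i : Fin (N + 1), ‖((Φ N).flow 0 z i).2‖ ^ 4)
              ∂(localGibbsLaw σ a₀ u₀ θ₀ N (Φ N))) ≤ ENNReal.ofReal B ∧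
            ∃ B' : ℝ, ∀ r : ℝ,
              (∫⁻ z, ENNReal.ofReal (((N : ℝ) + 1)⁻¹ *
                  ∑ i : Fin (N + 1), ‖((Φ N).flow r z i).2‖ ^ 4)
                ∂(localGibbsLaw σ a₀ u₀ θ₀ N (Φ N))) ≤ ENNReal.ofReal B' := by
  intro a₀ θ₀ u₀ ha hθ hu ha0 hθ0
  -- extrema of the continuous profiles on the compact torus
  obtain ⟨xM, -, hxM⟩ := isCompact_univ.exists_isMaxOn univ_nonempty hθ.continuousOn
  obtain ⟨U, hU⟩ : ∃ U : ℝ, ∀ x, ‖u₀ x‖ ≤ U := by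
    obtain ⟨C, hC⟩ := isCompact_univ.exists_bound_of_continuousOn hu.continuousOn
    exact ⟨C, fun x => hC x (mem_univ x)⟩
  have hmax : ∀ y, θ₀ y ≤ θ₀ xM := fun y => hxM (mem_univ y)
  have hK : 0 ≤ ∫ w, ‖w‖ ^ 4 ∂ProbabilityTheory.stdGaussian V3 :=
    integral_nonneg fun w => by positivity
  have hB0 : 0 ≤ 8 * U ^ 4 + 8 * θ₀ xM ^ 2 * ∫ w, ‖w‖ ^ 4 ∂ProbabilityTheory.stdGaussian V3 :=
    add_nonneg (by positivity) (mul_nonneg (by positivity) hK)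
  refine ⟨1 / 2, by norm_num, ?_⟩
  intro σ _ hσlt Φ
  have hσ2 : σ ≤ 1 / 2 := hσlt.le
  refine ⟨8 * U ^ 4 + 8 * θ₀ xM ^ 2 * ∫ w, ‖w‖ ^ 4 ∂ProbabilityTheory.stdGaussian V3, hB0, 0,
    fun N _ => ?_⟩
  have hN : ((N : ℝ) + 1) ≠ 0 := by positivity
  have hc : (0 : ℝ) ≤ ((N : ℝ) + 1)⁻¹ := by positivity
  have hsum := lintegral_quarticSum_localGibbsLaw_le ha hθ hu ha0 hθ0 hU hmax hσ2 N (Φ N)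
  have hmeasSum : Measurable fun z : Config (N + 1) (Fin 3) T3 =>
      ENNReal.ofReal (∑ i, ‖(z i).2‖ ^ 4) :=
    (Finset.measurable_sum _ fun i _ => (measurable_pi_apply i).snd.norm.pow_const 4).ennreal_ofReal
  refine ⟨?_, ((N : ℝ) + 1) *
    (8 * U ^ 4 + 8 * θ₀ xM ^ 2 * ∫ w, ‖w‖ ^ 4 ∂ProbabilityTheory.stdGaussian V3), fun r => ?_⟩
  · -- (i) the datum: `Φ_0 = id` a.e., then pull out the constant `(N+1)⁻¹`
    calc ∫⁻ z, ENNReal.ofReal (((N : ℝ) + 1)⁻¹ *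
            ∑ i : Fin (N + 1), ‖((Φ N).flow 0 z i).2‖ ^ 4) ∂(localGibbsLaw σ a₀ u₀ θ₀ N (Φ N))
        = ∫⁻ z, ENNReal.ofReal ((N : ℝ) + 1)⁻¹ * ENNReal.ofReal (∑ i, ‖(z i).2‖ ^ 4)
            ∂(localGibbsLaw σ a₀ u₀ θ₀ N (Φ N)) := by
          refine lintegral_congr_ae ?_
          filter_upwards [ae_mem_good_localGibbsLaw σ a₀ u₀ θ₀ N (Φ N)] with z hz
          rw [(Φ N).flow_zero z hz, ENNReal.ofReal_mul hc]
      _ = ENNReal.ofReal ((N : ℝ) + 1)⁻¹ *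
            ∫⁻ z, ENNReal.ofReal (∑ i, ‖(z i).2‖ ^ 4) ∂(localGibbsLaw σ a₀ u₀ θ₀ N (Φ N)) :=
          lintegral_const_mul _ hmeasSum
      _ ≤ ENNReal.ofReal ((N : ℝ) + 1)⁻¹ * ENNReal.ofReal (((N : ℝ) + 1) *
            (8 * U ^ 4 + 8 * θ₀ xM ^ 2 * ∫ w, ‖w‖ ^ 4 ∂ProbabilityTheory.stdGaussian V3)) :=
          mul_le_mul_right hsum _
      _ = _ := by rw [← ENNReal.ofReal_mul hc, inv_mul_cancel_left₀ hN]
  · -- (ii) crude bound along the flow: pathwise `(N+1)⁻¹ ∑ᵢ ‖vᵢ(r)‖⁴ ≤ ∑ᵢ ‖vᵢ(0)‖⁴` a.e.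
    calc ∫⁻ z, ENNReal.ofReal (((N : ℝ) + 1)⁻¹ *
            ∑ i : Fin (N + 1), ‖((Φ N).flow r z i).2‖ ^ 4) ∂(localGibbsLaw σ a₀ u₀ θ₀ N (Φ N))
        ≤ ∫⁻ z, ENNReal.ofReal (∑ i, ‖(z i).2‖ ^ 4) ∂(localGibbsLaw σ a₀ u₀ θ₀ N (Φ N)) := by
          refine lintegral_mono_ae ?_
          filter_upwards [ae_mem_good_localGibbsLaw σ a₀ u₀ θ₀ N (Φ N)] with z hz
          refine ENNReal.ofReal_le_ofReal ?_
          calc ((N : ℝ) + 1)⁻¹ * ∑ i, ‖((Φ N).flow r z i).2‖ ^ 4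
              ≤ ((N : ℝ) + 1)⁻¹ * (((N : ℝ) + 1) * ∑ i, ‖(z i).2‖ ^ 4) :=
                mul_le_mul_of_nonneg_left (quarticSum_flow_le_card_mul (Φ N) hz r) hc
            _ = ∑ i, ‖(z i).2‖ ^ 4 := inv_mul_cancel_left₀ hN _
      _ ≤ _ := hsum

end Summit.AtomisticToContinuum.HydrodynamicLimit.Theorems.QuarticSchurLedger

end
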